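import Summits.MatrixMultiplication.MatrixMultiplication.Theorems.EdgePencilSixthSymmetrisation
import HarnessLib

/-!
# The sixth-edge ladder, symmetrised (exponents): `(5 + δ)·ω(K₄) ≤ 6·χ(δ)` and the re-priced rungs

Support kernel for `stmt-MatrixMultiplication-26697` (`TetraExcessZero : ω(K₄) ≤ ω(2,1,2)`, the
attacked leaf of route `TetrahedronCarving`; lineage `decomp-mm-lens-6` «barrier-complement
carving», generation 23). Companion of `EdgePencilSixthSymmetrisation` (the finite law
`R₄(T(K₄)_{(e·n)·(n²·n²)}) ≤ R₄(W_n^{(e)})⁶`, `e ≤ n`). No item is added or changed.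

* §4 exponents: `ω(K₄) ≤ 6β/(5+δ)` for every `β` admissible for the `δ`-family `W_n^{(⌈n^δ⌉)}`
  (`0 ≤ δ ≤ 1`; one level `m_n = (⌈n^δ⌉·n)·(n²·n²) ≥ n^{5+δ}` certifies, `omegaTetra_le_of_level`), hence
  `(5+δ)·ω(K₄) ≤ 6·χ(δ)` (`omegaTetra_le_symm_six`, `le_omegaSix_symm`) and the top continuity
  `ω(K₄) − χ(δ) ≤ (1−δ)/6 · ω(K₄) ≤ 1 − δ` (`omegaTetra_sub_omegaSix_le`) — versus the block bound
  `ω(K₄) ≤ χ(δ) + (1−δ)` of `EdgePencilSixthLadder` (the two agree only at `ω(K₄) = 6`).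
* §5 the ladder, re-priced: a rung `χ(δ) ≤ ω(2,1,2)` gives `ω(K₄) ≤ 6·ω(2,1,2)/(5+δ)`, i.e. the
  EXCESS bound `ω(K₄) − ω(2,1,2) ≤ (1−δ)/(5+δ) · ω(2,1,2)` (`omegaTetra_le_of_sixRung_symm`,
  `excess_le_of_sixRung_symm`; never worse than the linear `ω(2,1,2) + 1 − δ` because `ω(2,1,2) ≤ 5`,
  `symmThreshold_le_linearThreshold`); unconditionally (the bottom rung `δ = 0` is the theorem
  `sixRung_zero`) `5·ω(K₄) ≤ 6·ω(2,1,2)` and `ω(K₄) ≤ (6/5)(ω + 2)` (`five_mul_omegaTetra_le`,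
  `omegaTetra_le_six_fifths`, `excess_le_fifth`); the half rung alone gives `11·ω(K₄) ≤ 12·ω(2,1,2)`
  (`omegaTetra_le_of_sixRung_half`); `tetraExcess_le_of_sixRung` states the excess bound over `ℂ` next
  to the leaf `TetraExcessZero`.
  Numerically (printed values, NOT tree facts: `ω(2,1,2) = 2·ω(1,½,1) ≤ 4.088366`,
  `ω(K₄) ≤ 4.633908` [BCKLOSW26, Thm. 48]): a rung at `δ` is NEWS iff `6·4.088366/(5+δ) < 4.633908`,
  i.e. `δ > 0.2937` (the linear pricing needed `δ > 0.4545`); the half rung would give `ω(K₄) ≤ 4.4601`.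

References: Christandl–Vrana–Zuiddam, arXiv:1609.07476, §2.1 `(nonuniformsymm)`, Thm. 2.1.6,
Prop. 1.1.16 [ChristandlVranaZuiddam2016]; [corpus:paper-arxiv-1609.07476 p.11–12].
No `sorry`, no new axiom, no instance, no notation, no definition.
-/

noncomputable section

set_option linter.dupNamespace false

open Filter Asymptotics Literature.Computability.AlgebraicComplexity
open Summit.MatrixMultiplication.MatrixMultiplication.Theorems.TetrahedronTensor
open Summit.MatrixMultiplication.MatrixMultiplication.Theorems.TetraDiagonal
open Summit.MatrixMultiplication.MatrixMultiplication.Theses.TetrahedronCarving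

namespace Summit.MatrixMultiplication.MatrixMultiplication.Theorems.EdgePencil

/-! ## §4 Exponents: `(5 + δ)·ω(K₄) ≤ 6·χ(δ)` -/

section Exponent

variable (F : Type) [Field F]

/-- **Symmetrisation, admissible-exponent form**: if `β` is admissible for the `δ`-family
(`0 ≤ δ ≤ 1`) then `ω(K₄) ≤ 6β/(5+δ)`: at the levels `m_n = (⌈n^δ⌉·n)·(n²·n²) ≥ n^{5+δ}`,
`R₄(T(K₄)_{m_n}) ≤ (C n^β)⁶ = m_n^{θ_n}` with `θ_n → 6β/(5+δ)`, and one level certifies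
(`omegaTetra_le_of_level`). [cite: ChristandlVranaZuiddam2016, §2.1 (nonuniformsymm)] -/
theorem omegaTetra_le_of_mem_sixAdmissibleExponents {δ β : ℝ} (hδ0 : 0 ≤ δ) (hδ1 : δ ≤ 1)
    (hβ : β ∈ sixAdmissibleExponents F δ) : omegaTetra F ≤ 6 * β / (5 + δ) := by
  have hβ0 : 0 ≤ β :=
    rectAdmissibleExponents_nonneg F (pencilAdmissibleExponents_subset_rect F le_rfl
      (sixAdmissibleExponents_subset_pencil_one F δ hβ))
  obtain ⟨C, hC0, hC⟩ := bound_of_isBigO_nat_atTop hβ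
  -- enlarge the constant to `C' ≥ 1`
  set C' : ℝ := max C 1 with hC'
  have hC'1 : 1 ≤ C' := le_max_right _ _
  have hC'pos : 0 < C' := by linarith
  have hlogC' : 0 ≤ Real.log C' := Real.log_nonneg hC'1
  have h5δ : 0 < 5 + δ := by linarith
  refine le_of_forall_pos_le_add fun η hη => ?_
  -- choose the level parameter `n`
  obtain ⟨n, hn2, hnlog⟩ : ∃ n : ℕ, 2 ≤ n ∧ 6 * Real.log C' / ((5 + δ) * η) ≤ Real.log n := by
    refine ⟨max 2 ⌈Real.exp (6 * Real.log C' / ((5 + δ) * η))⌉₊, le_max_left _ _, ?_⟩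
    have hE := Real.exp_pos (6 * Real.log C' / ((5 + δ) * η))
    have h1 : Real.exp (6 * Real.log C' / ((5 + δ) * η)) ≤
        ((max 2 ⌈Real.exp (6 * Real.log C' / ((5 + δ) * η))⌉₊ : ℕ) : ℝ) := by
      calc Real.exp (6 * Real.log C' / ((5 + δ) * η))
          ≤ (⌈Real.exp (6 * Real.log C' / ((5 + δ) * η))⌉₊ : ℝ) := Nat.le_ceil _
        _ ≤ ((max 2 ⌈Real.exp (6 * Real.log C' / ((5 + δ) * η))⌉₊ : ℕ) : ℝ) := by
            exact_mod_cast le_max_right _ _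
    have h2 := Real.log_le_log hE h1
    rwa [Real.log_exp] at h2
  have hn1 : 1 ≤ n := by omega
  have hnR : (2 : ℝ) ≤ n := by exact_mod_cast hn2
  have hnpos : (0 : ℝ) < n := by linarith
  have hlogn : 0 < Real.log n := Real.log_pos (by linarith)
  -- the light bond and the level
  set dn : ℕ := rectDim n δ with hdn
  have hdn1 : 1 ≤ dn := one_le_rectDim hn1 δ
  have hdnn : dn ≤ n := (rectDim_mono hn1 hδ1).trans (rectDim_one n).le
  have hdnge : (n : ℝ) ^ δ ≤ (dn : ℝ) := Nat.le_ceil _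
  set m : ℕ := (dn * n) * ((n * n) * (n * n)) with hm
  have hm2 : 2 ≤ m := by
    have : (1 * 2) * ((1 * 1) * (1 * 1)) ≤ (dn * n) * ((n * n) * (n * n)) :=
      Nat.mul_le_mul (Nat.mul_le_mul hdn1 hn2)
        (Nat.mul_le_mul (Nat.mul_le_mul hn1 hn1) (Nat.mul_le_mul hn1 hn1))
    omega
  have hmR : (2 : ℝ) ≤ m := by exact_mod_cast hm2
  have hmpos : (0 : ℝ) < m := by linarith
  have hlogm : 0 < Real.log m := Real.log_pos (by linarith)
  -- the rank bound on `W_n^{(dn)}`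
  have hW : (tensorRankD (sixTetra F n dn) : ℝ) ≤ C' * (n : ℝ) ^ β := by
    have hne : ((n : ℕ) : ℝ) ^ β ≠ 0 := (Real.rpow_pos_of_pos hnpos β).ne'
    have h := hC hne
    rw [Real.norm_of_nonneg (Nat.cast_nonneg _),
      Real.norm_of_nonneg (Real.rpow_nonneg (Nat.cast_nonneg _) _)] at h
    exact h.trans (mul_le_mul_of_nonneg_right (le_max_left _ _) (Real.rpow_nonneg hnpos.le _))
  have hW0 : (0 : ℝ) ≤ (tensorRankD (sixTetra F n dn) : ℝ) := Nat.cast_nonneg _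
  set B : ℝ := C' ^ 6 * (n : ℝ) ^ (6 * β) with hB
  have hB1 : 1 ≤ B := by
    have h1 : (1 : ℝ) ≤ C' ^ 6 := one_le_pow₀ hC'1
    have h2 : (1 : ℝ) ≤ (n : ℝ) ^ (6 * β) := Real.one_le_rpow (by linarith) (by positivity)
    nlinarith
  have hBpos : 0 < B := by linarith
  have hsix : (tensorRankD (tetra F m) : ℝ) ≤ B := by
    have h := tensorRankD_tetra_le_sixTetra_pow_six (F := F) (n := n) (e := dn) hdnn
    calc (tensorRankD (tetra F m) : ℝ) ≤ ((tensorRankD (sixTetra F n dn) ^ 6 : ℕ) : ℝ) := by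
          exact_mod_cast h
      _ = (tensorRankD (sixTetra F n dn) : ℝ) ^ 6 := by push_cast; ring
      _ ≤ (C' * (n : ℝ) ^ β) ^ 6 := pow_le_pow_left₀ hW0 hW 6
      _ = B := by
          rw [hB, mul_pow, ← Real.rpow_natCast ((n : ℝ) ^ β) 6, ← Real.rpow_mul hnpos.le]
          norm_num [mul_comm]
  -- the level certificate `R₄(T(K₄)_m) ≤ m^θ`, `θ = log B / log m`
  set θ : ℝ := Real.log B / Real.log m with hθ
  have hθ0 : 0 ≤ θ := div_nonneg (Real.log_nonneg hB1) hlogm.le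
  have hcert : (tensorRankD (tetra F m) : ℝ) ≤ (m : ℝ) ^ θ := by
    have hlθ : Real.log (m : ℝ) * θ = Real.log B := by
      rw [hθ]; field_simp
    have : (m : ℝ) ^ θ = B := by
      rw [Real.rpow_def_of_pos hmpos, hlθ, Real.exp_log hBpos]
    rw [this]
    exact hsix
  have hω : omegaTetra F ≤ θ := omegaTetra_le_of_level F hm2 hθ0 hcert
  -- `θ ≤ 6β/(5+δ) + η`
  have h5 : (n : ℝ) ^ (5 : ℝ) = (n : ℝ) ^ (5 : ℕ) := by exact_mod_cast Real.rpow_natCast (n : ℝ) 5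
  have hlogm_ge : (5 + δ) * Real.log n ≤ Real.log m := by
    have h1 : (n : ℝ) ^ (5 + δ) ≤ (m : ℝ) := by
      have hsplit : (n : ℝ) ^ (5 + δ) = (n : ℝ) ^ (5 : ℕ) * (n : ℝ) ^ δ := by
        rw [Real.rpow_add hnpos, h5]
      rw [hsplit, hm]
      push_cast
      have h := mul_le_mul_of_nonneg_left hdnge (show (0 : ℝ) ≤ (n : ℝ) ^ (5 : ℕ) by positivity)
      calc (n : ℝ) ^ (5 : ℕ) * (n : ℝ) ^ δ ≤ (n : ℝ) ^ (5 : ℕ) * (dn : ℝ) := h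
        _ = (dn : ℝ) * n * ((n * n) * (n * n)) := by ring
    have h2 := Real.log_le_log (Real.rpow_pos_of_pos hnpos _) h1
    rwa [Real.log_rpow hnpos] at h2
  have hlogB : Real.log B = 6 * Real.log C' + 6 * β * Real.log n := by
    rw [hB, Real.log_mul (pow_pos hC'pos 6).ne' (Real.rpow_pos_of_pos hnpos _).ne', Real.log_pow,
      Real.log_rpow hnpos]
    push_cast
    ring
  have hθle : θ ≤ (6 * Real.log C' + 6 * β * Real.log n) / ((5 + δ) * Real.log n) := by
    rw [hθ, hlogB]
    exact div_le_div_of_nonneg_left (by positivity) (by positivity) hlogm_ge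
  have hsplit : (6 * Real.log C' + 6 * β * Real.log n) / ((5 + δ) * Real.log n) =
      6 * β / (5 + δ) + 6 * Real.log C' / ((5 + δ) * Real.log n) := by
    field_simp
    ring
  have htail : 6 * Real.log C' / ((5 + δ) * Real.log n) ≤ η := by
    rw [div_le_iff₀ (by positivity)]
    have h := hnlog
    rw [div_le_iff₀ (by positivity)] at h
    linarith
  linarith

/-- **`ω(K₄) ≤ 6·χ(δ)/(5+δ)`** for `0 ≤ δ ≤ 1` (equality at `δ = 1`, `omegaSix_one`).
[cite: ChristandlVranaZuiddam2016, §2.1 (nonuniformsymm)] -/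
theorem omegaTetra_le_symm_six {δ : ℝ} (hδ0 : 0 ≤ δ) (hδ1 : δ ≤ 1) :
    omegaTetra F ≤ 6 * omegaSix F δ / (5 + δ) := by
  have h5δ : 0 < 5 + δ := by linarith
  refine le_of_forall_pos_le_add fun η hη => ?_
  obtain ⟨β, hβ, hβlt⟩ := Real.lt_sInf_add_pos (sixAdmissibleExponents_nonempty F δ)
    (show 0 < η * (5 + δ) / 6 by positivity)
  have h := omegaTetra_le_of_mem_sixAdmissibleExponents F hδ0 hδ1 hβ
  have hβle : β ≤ omegaSix F δ + η * (5 + δ) / 6 := by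
    show β ≤ sInf (sixAdmissibleExponents F δ) + η * (5 + δ) / 6
    exact hβlt.le
  calc omegaTetra F ≤ 6 * β / (5 + δ) := h
    _ ≤ 6 * (omegaSix F δ + η * (5 + δ) / 6) / (5 + δ) := by gcongr
    _ = 6 * omegaSix F δ / (5 + δ) + η := by field_simp

/-- **`(5+δ)/6 · ω(K₄) ≤ χ(δ)`** (`0 ≤ δ ≤ 1`): the uniform tetrahedron minimises exponent per unit of
bond mass along the sixth-edge family. [cite: ChristandlVranaZuiddam2016, §2.1 (nonuniformsymm)] -/
theorem le_omegaSix_symm {δ : ℝ} (hδ0 : 0 ≤ δ) (hδ1 : δ ≤ 1) :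
    (5 + δ) / 6 * omegaTetra F ≤ omegaSix F δ := by
  have h := omegaTetra_le_symm_six F hδ0 hδ1
  have h5δ : 0 < 5 + δ := by linarith
  rw [le_div_iff₀ h5δ] at h
  have : (5 + δ) / 6 * omegaTetra F = omegaTetra F * (5 + δ) / 6 := by ring
  rw [this, div_le_iff₀ (by norm_num : (0 : ℝ) < 6)]
  linarith

/-- **Continuity of the ladder at the top, symmetrised**: `ω(K₄) − χ(δ) ≤ (1−δ)/6 · ω(K₄) ≤ 1 − δ`
(`0 ≤ δ ≤ 1`; compare the block bound `ω(K₄) ≤ χ(δ) + (1 − δ)`, `omegaTetra_le_omegaSix_add`).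
[cite: ChristandlVranaZuiddam2016, §2.1 (nonuniformsymm)] -/
theorem omegaTetra_sub_omegaSix_le {δ : ℝ} (hδ0 : 0 ≤ δ) (hδ1 : δ ≤ 1) :
    omegaTetra F - omegaSix F δ ≤ (1 - δ) / 6 * omegaTetra F ∧
      omegaTetra F - omegaSix F δ ≤ 1 - δ := by
  have h := le_omegaSix_symm F hδ0 hδ1
  have h6 := omegaTetra_le_six F
  have h4 := four_le_omegaTetra F
  constructor
  · linarith
  · nlinarith

end Exponent

/-! ## §5 The ladder re-priced: a rung at `δ` bounds the excess by `(1−δ)/(5+δ) · ω(2,1,2)` -/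

section Rungs

variable (F : Type) [Field F]

/-- **A rung is partial progress, symmetrised**: `χ(δ) ≤ ω(2,1,2) ⟹ ω(K₄) ≤ 6·ω(2,1,2)/(5+δ)`
(`0 ≤ δ ≤ 1`). [cite: ChristandlVranaZuiddam2016, §2.1 (nonuniformsymm)] -/
theorem omegaTetra_le_of_sixRung_symm {δ : ℝ} (hδ0 : 0 ≤ δ) (hδ1 : δ ≤ 1)
    (hr : omegaSix F δ ≤ omegaRect F 2 1 2) :
    omegaTetra F ≤ 6 * omegaRect F 2 1 2 / (5 + δ) := by
  have h5δ : 0 < 5 + δ := by linarith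
  calc omegaTetra F ≤ 6 * omegaSix F δ / (5 + δ) := omegaTetra_le_symm_six F hδ0 hδ1
    _ ≤ 6 * omegaRect F 2 1 2 / (5 + δ) := by gcongr

/-- **Excess form**: a rung at `δ` gives `ω(K₄) − ω(2,1,2) ≤ (1−δ)/(5+δ) · ω(2,1,2)` (`0 ≤ δ ≤ 1`).
[cite: ChristandlVranaZuiddam2016, §2.1 (nonuniformsymm)] -/
theorem excess_le_of_sixRung_symm {δ : ℝ} (hδ0 : 0 ≤ δ) (hδ1 : δ ≤ 1)
    (hr : omegaSix F δ ≤ omegaRect F 2 1 2) :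
    omegaTetra F - omegaRect F 2 1 2 ≤ (1 - δ) / (5 + δ) * omegaRect F 2 1 2 := by
  have h := omegaTetra_le_of_sixRung_symm F hδ0 hδ1 hr
  have h5δ : 0 < 5 + δ := by linarith
  rw [le_div_iff₀ h5δ] at h
  have hrew : (1 - δ) / (5 + δ) * omegaRect F 2 1 2 =
      (6 * omegaRect F 2 1 2 - (5 + δ) * omegaRect F 2 1 2) / (5 + δ) := by
    field_simp
    ring
  rw [hrew, le_div_iff₀ h5δ]
  nlinarith

/-- The symmetrised pricing of a rung is never worse than the linear one of `EdgePencilSixthLadder`: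
`6·ω(2,1,2)/(5+δ) ≤ ω(2,1,2) + (1 − δ)` for `0 ≤ δ ≤ 1` (because `ω(2,1,2) ≤ ω + 2 ≤ 5 ≤ 5 + δ`). -/
theorem symmThreshold_le_linearThreshold {δ : ℝ} (hδ0 : 0 ≤ δ) (hδ1 : δ ≤ 1) :
    6 * omegaRect F 2 1 2 / (5 + δ) ≤ omegaRect F 2 1 2 + (1 - δ) := by
  have h5δ : 0 < 5 + δ := by linarith
  have hP : omegaRect F 2 1 2 ≤ 5 := by
    have h1 := omegaPencil_one_le_omega_add_two F
    rw [omegaPencil_one_eq_omegaRect_two_one_two] at h1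
    linarith [omega_le_three' F]
  rw [div_le_iff₀ h5δ]
  nlinarith

/-- News threshold, symmetrised: a rung at `δ` with `6·ω(2,1,2)/(5+δ) < c` gives `ω(K₄) < c` (with the
printed `ω(2,1,2) ≤ 4.088366` and `c = 4.633908` this needs only `δ > 0.2937`). -/
theorem omegaTetra_lt_of_sixRung_symm {δ c : ℝ} (hδ0 : 0 ≤ δ) (hδ1 : δ ≤ 1)
    (hr : omegaSix F δ ≤ omegaRect F 2 1 2) (hc : 6 * omegaRect F 2 1 2 / (5 + δ) < c) :
    omegaTetra F < c :=
  lt_of_le_of_lt (omegaTetra_le_of_sixRung_symm F hδ0 hδ1 hr) hc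

/-- **Unconditional** (`δ = 0`: the bottom rung `χ(0) ≤ ω(2,1,2)` is the theorem `sixRung_zero`):
`5·ω(K₄) ≤ 6·ω(2,1,2)`. [cite: ChristandlVranaZuiddam2016, §2.1 (nonuniformsymm)] -/
theorem five_mul_omegaTetra_le : 5 * omegaTetra F ≤ 6 * omegaRect F 2 1 2 := by
  have h := omegaTetra_le_of_sixRung_symm F le_rfl zero_le_one (sixRung_zero F)
  rw [add_zero, le_div_iff₀ (by norm_num : (0 : ℝ) < 5)] at h
  linarith

/-- Hence `ω(K₄) ≤ (6/5)·(ω + 2)` (with `ω(2,1,2) = ψ(1) ≤ ω + 2`). -/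
theorem omegaTetra_le_six_fifths : omegaTetra F ≤ 6 / 5 * (omega F + 2) := by
  have h := five_mul_omegaTetra_le F
  have h1 := omegaPencil_one_le_omega_add_two F
  rw [omegaPencil_one_eq_omegaRect_two_one_two] at h1
  linarith

/-- The unconditional excess bound: `ω(K₄) − ω(2,1,2) ≤ ω(2,1,2)/5`. -/
theorem excess_le_fifth : omegaTetra F - omegaRect F 2 1 2 ≤ omegaRect F 2 1 2 / 5 := by
  have h := five_mul_omegaTetra_le F
  linarith

/-- **The half rung alone**: `χ(1/2) ≤ ω(2,1,2) ⟹ 11·ω(K₄) ≤ 12·ω(2,1,2)` (printed values would give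
`ω(K₄) ≤ 4.4601 < 4.633908`). [cite: ChristandlVranaZuiddam2016, §2.1 (nonuniformsymm)] -/
theorem omegaTetra_le_of_sixRung_half (hr : omegaSix F (1 / 2) ≤ omegaRect F 2 1 2) :
    11 * omegaTetra F ≤ 12 * omegaRect F 2 1 2 := by
  have h := omegaTetra_le_of_sixRung_symm F (by norm_num) (by norm_num) hr
  rw [le_div_iff₀ (by norm_num : (0 : ℝ) < 5 + 1 / 2)] at h
  linarith

/-- Over `ℂ`, in the route's vocabulary: a rung at `δ ∈ [0,1]` bounds the leaf's own quantity,
`ω(K₄) − ω(2,1,2) ≤ (1−δ)/(5+δ) · ω(2,1,2)`, and `TetraExcessZero` is the statement that this holds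
with `0` on the right. [cite: ChristandlVranaZuiddam2016, §2.1 (nonuniformsymm)] -/
theorem tetraExcess_le_of_sixRung {δ : ℝ} (hδ0 : 0 ≤ δ) (hδ1 : δ ≤ 1)
    (hr : omegaSix ℂ δ ≤ omegaRect ℂ 2 1 2) :
    omegaTetra ℂ - omegaRect ℂ 2 1 2 ≤ (1 - δ) / (5 + δ) * omegaRect ℂ 2 1 2 ∧
      (TetraExcessZero ↔ omegaTetra ℂ - omegaRect ℂ 2 1 2 ≤ 0) :=
  ⟨excess_le_of_sixRung_symm ℂ hδ0 hδ1 hr, by unfold TetraExcessZero; constructor <;> intro h <;> linarith⟩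

end Rungs

end Summit.MatrixMultiplication.MatrixMultiplication.Theorems.EdgePencil

end
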